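import Mathlib
import Literature.NumberTheory.Transcendental.AssociatorsEval
import HarnessLib

/-!
# The 5-cycle rearrangement of a pentagon solution inside `U𝔞₄` (Furusho 2010, proof of Lemma 5)

Sibling file of `Associators.lean` (Part B.2 of the proof of `furusho_pentagon_doubleShuffle`
[Furusho2011, Thm 1.2]); everything is proved, no named facts. For a group-like
`φ ∈ R⟨⟨X₀, X₁⟩⟩` (`R` a commutative `ℚ`-algebra) satisfying Drinfeld's pentagon equation
(`NCSeries.DrinfeldPentagon`, stated in the weight-truncated Drinfeld–Kohno algebras `U𝔞₄`) we
prove: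

* `NCSeries.DrinfeldPentagon.gokakukei` — the image of the pentagon in the form
  `φ(a, e) φ(d, c) = φ(b, c) φ(d, e) φ(a, b)` [Furusho2010, eq. (5) in the proof of Lemma 5] with
  `a = t₁₂, b = t₂₃, c = t₃₄, d = t₁₂ + t₁₃ + t₂₃, e = t₂₃ + t₂₄ + t₃₄` (the lifts to `U𝔞₄` of the
  cyclic generators `X₁₂, X₂₃, X₃₄, X₄₅, X₅₁` of `U𝔓₅`), obtained from the pentagon by Furusho's
  shift remark `φ(A + C, B) = φ(A, B + C) = φ(A, B)` for `[A,C] = [B,C] = 0`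
  (`IsGroupLike.subst₂_add_left/right` of `AssociatorsEval.lean`); we stay inside `U𝔞₄` and never
  form the quotient `U𝔓₅`.
* `NCSeries.DrinfeldPentagon.eval_point_eq` — the rearrangement
  `φ(d, e) φ(a, b) = φ(c, b) φ(a, e) φ(d, c)` of Furusho's evaluation point `φ₄₅₁ φ₁₂₃`
  [Furusho2011, proof of Lemma 5.2: "Because (5-cycle) implies `φ(X₀,X₁)φ(X₁,X₀) = 1` … we have
  `φ₄₅₁φ₁₂₃ = φ₄₃₂φ₂₁₅φ₅₄₃`"], from `gokakukei` and the 2-cycle relation [Furusho2010, Lemma 6]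
  (`NCSeries.DrinfeldPentagon.two_cycle` of `AssociatorsProofs.lean`).

Strands `1,2,3,4` of the papers are `0,1,2,3 : Fin 4` here (`NCSeries.t₄`).

## References

* H. Furusho, *Pentagon and hexagon equations*, Ann. of Math. 171 (2010), 545–556, Lemmas 5, 6
  (arXiv:math/0702128, p. 7). [Furusho2010]
* H. Furusho, *Double shuffle relation for associators*, Ann. of Math. 174 (2011), §2, §5 (proof
  of Lemma 5.2). [Furusho2011]
-/

noncomputable section

open scoped BigOperators

namespace Literature.NumberTheory.Transcendental

universe u v

namespace NCSeries

/-! ## B.2.1 Algebra maps and `φ(·,·)` -/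

variable {R : Type v} [CommRing R] [Algebra ℚ R]

omit [Algebra ℚ R] in
/-- An algebra map commutes with `φ(·,·)`: `F(φ(a, b)) = φ(F a, F b)`. [folklore] -/
theorem algHom_subst₂ {A B : Type*} [Ring A] [Algebra R A] [Ring B] [Algebra R B] (F : A →ₐ[R] B)
    (N : ℕ) (φ : NCSeries Bool R) (a b : A) : F (subst₂ N φ a b) = subst₂ N φ (F a) (F b) := by
  rw [subst₂, algHom_evalTrunc]
  congr 1
  funext c
  cases c <;> rfl

/-! ## B.2.2 The pentagon rearranged inside `U𝔞₄` (Furusho 2010, proof of Lemma 5) -/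

section InDK

variable {φ : NCSeries Bool R} {N : ℕ}

open DrinfeldKohnoTrunc in
/-- **Furusho's form (5) of the pentagon** [Furusho2010, proof of Lemma 5, the display before
"The following lemma"]: with `a = t₁₂`, `b = t₂₃`, `c = t₃₄`, `d = t₁₂ + t₁₃ + t₂₃`,
`e = t₂₃ + t₂₄ + t₃₄` (lifts to `U𝔞₄` of `X₁₂, X₂₃, X₃₄, X₄₅, X₅₁`), a group-like pentagon solution
satisfies `φ(a, e) φ(d, c) = φ(b, c) φ(d, e) φ(a, b)` ("gokakukei") in every weight truncation of
`U𝔞₄`. It is the pentagon with each factor shifted by a central-enough generator, using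
`φ(A + C, B) = φ(A, B + C) = φ(A, B)` for `[A,C] = [B,C] = 0` (strands `1..4` are `0..3` here).
[cite: Furusho2010, Lemma 5 (proof)] -/
theorem DrinfeldPentagon.gokakukei (h : DrinfeldPentagon φ) (hg : IsGroupLike φ) (N : ℕ) :
    subst₂ N φ (t₄ R N 0 1) (t₄ R N 1 2 + t₄ R N 1 3 + t₄ R N 2 3) *
        subst₂ N φ (t₄ R N 0 1 + t₄ R N 0 2 + t₄ R N 1 2) (t₄ R N 2 3) =
      subst₂ N φ (t₄ R N 1 2) (t₄ R N 2 3) *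
        subst₂ N φ (t₄ R N 0 1 + t₄ R N 0 2 + t₄ R N 1 2) (t₄ R N 1 2 + t₄ R N 1 3 + t₄ R N 2 3) *
        subst₂ N φ (t₄ R N 0 1) (t₄ R N 1 2) := by
  have hX0 : φ [false] = 0 := h.apply_letter_eq_zero_of_isGroupLike hg false
  have hX1 : φ [true] = 0 := h.apply_letter_eq_zero_of_isGroupLike hg true
  let S : Submodule R (DrinfeldKohnoTrunc R (Fin 4) N) := genSpan
  have hS := fun l => list_prod_eq_zero_of_mem_genSpan (R := R) (ι := Fin 4) (N := N) l
  have ht : ∀ i j : Fin 4, t₄ R N i j ∈ S := fun i j => t_mem_genSpan i j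
  -- the commutation relations used (4T and locality); `t₄ R N i j = t R N i j` over `Fin 4`
  have c01_23 : Commute (t₄ R N 0 1) (t₄ R N 2 3) :=
    (commute_iff_eq _ _).mpr (t_comm (R := R) (N := N) (0 : Fin 4) 1 2 3 (by decide) (by decide)
      (by decide) (by decide) (by decide) (by decide))
  have c4T : ∀ i j k : Fin 4, i ≠ j → j ≠ k → i ≠ k →
      t R N i j * (t R N i k + t R N j k) = (t R N i k + t R N j k) * t R N i j :=
    fun i j k => t_mul_add (R := R) (N := N) i j k
  have c23_1213 : Commute (t₄ R N 1 2 + t₄ R N 1 3) (t₄ R N 2 3) := by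
    have := c4T 2 3 1 (by decide) (by decide) (by decide)
    rw [t_symm (R := R) (N := N) (2 : Fin 4) 1, t_symm (R := R) (N := N) (3 : Fin 4) 1] at this
    exact ((commute_iff_eq _ _).mpr this).symm
  have c01_0212 : Commute (t₄ R N 0 2 + t₄ R N 1 2) (t₄ R N 0 1) :=
    ((commute_iff_eq _ _).mpr (c4T 0 1 2 (by decide) (by decide) (by decide))).symm
  have c12_0102 : Commute (t₄ R N 0 1 + t₄ R N 0 2) (t₄ R N 1 2) := by
    have := c4T 1 2 0 (by decide) (by decide) (by decide)
    rw [t_symm (R := R) (N := N) (1 : Fin 4) 0, t_symm (R := R) (N := N) (2 : Fin 4) 0] at this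
    exact ((commute_iff_eq _ _).mpr this).symm
  have c12_1323 : Commute (t₄ R N 1 3 + t₄ R N 2 3) (t₄ R N 1 2) :=
    ((commute_iff_eq _ _).mpr (c4T 1 2 3 (by decide) (by decide) (by decide))).symm
  have cd_12 : Commute (t₄ R N 0 1 + t₄ R N 0 2 + t₄ R N 1 2) (t₄ R N 1 2) :=
    c12_0102.add_left (Commute.refl _)
  -- shift the three factors of the pentagon
  have e1 : subst₂ N φ (t₄ R N 0 1) (t₄ R N 1 2 + t₄ R N 1 3) =
      subst₂ N φ (t₄ R N 0 1) (t₄ R N 1 2 + t₄ R N 1 3 + t₄ R N 2 3) :=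
    (hg.subst₂_add_right S hS hX1 (ht 0 1) (S.add_mem (ht 1 2) (ht 1 3)) (ht 2 3) c01_23
      c23_1213).symm
  have e2 : subst₂ N φ (t₄ R N 0 2 + t₄ R N 1 2) (t₄ R N 2 3) =
      subst₂ N φ (t₄ R N 0 1 + t₄ R N 0 2 + t₄ R N 1 2) (t₄ R N 2 3) := by
    rw [← hg.subst₂_add_left S hS hX0 (S.add_mem (ht 0 2) (ht 1 2)) (ht 2 3) (ht 0 1) c01_0212
      c01_23.symm]
    congr 1
    abel
  have e3 : subst₂ N φ (t₄ R N 0 1 + t₄ R N 0 2) (t₄ R N 1 3 + t₄ R N 2 3) =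
      subst₂ N φ (t₄ R N 0 1 + t₄ R N 0 2 + t₄ R N 1 2) (t₄ R N 1 2 + t₄ R N 1 3 + t₄ R N 2 3) := by
    rw [← hg.subst₂_add_left S hS hX0 (S.add_mem (ht 0 1) (ht 0 2)) (S.add_mem (ht 1 3) (ht 2 3))
      (ht 1 2) c12_0102 c12_1323,
      ← hg.subst₂_add_right S hS hX1 (S.add_mem (S.add_mem (ht 0 1) (ht 0 2)) (ht 1 2))
      (S.add_mem (ht 1 3) (ht 2 3)) (ht 1 2) cd_12 c12_1323]
    congr 1
    abel
  have hp := h N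
  rw [e1, e2, e3] at hp
  exact hp

open DrinfeldKohnoTrunc in
/-- The 2-cycle relation [Furusho2010, Lemma 6] (`DrinfeldPentagon.two_cycle` of
`AssociatorsProofs.lean`, evaluated by `two_cycle_eval`) inside `U𝔞₄`: `φ(c, b) φ(b, c) = 1` for
generators `b = t i j`, `c = t k l`. [cite: Furusho2010, Lemma 6] -/
theorem DrinfeldPentagon.subst₂_t_swap_mul (h : DrinfeldPentagon φ) (hg : IsGroupLike φ) (N : ℕ)
    (i j k l : Fin 4) :
    subst₂ N φ (t₄ R N k l) (t₄ R N i j) * subst₂ N φ (t₄ R N i j) (t₄ R N k l) = 1 := by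
  have hv : ∀ c, bsub (t₄ R N i j) (t₄ R N k l) c ∈
      (genSpan : Submodule R (DrinfeldKohnoTrunc R (Fin 4) N)) := fun c => by
    cases c <;> exact t_mem_genSpan _ _
  exact (two_cycle_eval (h.two_cycle hg) N (prod_map_eq_zero_of_mem_genSpan _ hv)).2

open DrinfeldKohnoTrunc in
/-- **Rearrangement of Furusho's evaluation point** [Furusho2011, proof of Lemma 5.2:
"Because (5-cycle) implies `φ(X₀,X₁)φ(X₁,X₀) = 1` … we have `φ₄₅₁φ₁₂₃ = φ₄₃₂φ₂₁₅φ₅₄₃`"], lifted to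
`U𝔞₄`: `φ(d, e) φ(a, b) = φ(c, b) φ(a, e) φ(d, c)` with `a, b, c, d, e` as in
`DrinfeldPentagon.gokakukei`. [cite: Furusho2011, Lemma 5.2 (proof)] -/
theorem DrinfeldPentagon.eval_point_eq (h : DrinfeldPentagon φ) (hg : IsGroupLike φ) (N : ℕ) :
    subst₂ N φ (t₄ R N 0 1 + t₄ R N 0 2 + t₄ R N 1 2) (t₄ R N 1 2 + t₄ R N 1 3 + t₄ R N 2 3) *
        subst₂ N φ (t₄ R N 0 1) (t₄ R N 1 2) =
      subst₂ N φ (t₄ R N 2 3) (t₄ R N 1 2) *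
        subst₂ N φ (t₄ R N 0 1) (t₄ R N 1 2 + t₄ R N 1 3 + t₄ R N 2 3) *
        subst₂ N φ (t₄ R N 0 1 + t₄ R N 0 2 + t₄ R N 1 2) (t₄ R N 2 3) := by
  rw [mul_assoc, h.gokakukei hg N, ← mul_assoc, ← mul_assoc, h.subst₂_t_swap_mul hg N 1 2 2 3,
    one_mul]

end InDK

end NCSeries

end Literature.NumberTheory.Transcendental
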